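import Summits.CriticalPhenomena.CardyFormulaZ2.Theorems.CardySelfDualSegmentUniformBoxCrossingDefs2
import Summits.CriticalPhenomena.CardyFormulaZ2.Theorems.CardySelfDualSegmentUniformBoxCrossingGoodShifts
import Summits.CriticalPhenomena.CardyFormulaZ2.Theorems.CardySelfDualSegmentUniformBoxCrossingStubBRChainPart1
import Summits.CriticalPhenomena.CardyFormulaZ2.Theorems.CardySelfDualSegmentUniformBoxCrossingStubJoin
import Summits.CriticalPhenomena.CardyFormulaZ2.Theorems.CardySelfDualSegmentUniformBoxCrossingStubAssemblyPart1
import Summits.CriticalPhenomena.CardyFormulaZ2.Theorems.CardySelfDualSegmentUniformBoxCrossingStubAssemblyPart2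
import Summits.CriticalPhenomena.CardyFormulaZ2.Theorems.CardySelfDualSegmentUniformBoxCrossingStubAssemblyPart3
import HarnessLib

/-!
# Stub `stub_assembly` (crux stmt-CriticalPhenomena-5476 `UniformBoxCrossing`, line `Sketch`):
# the probabilistic wrapping of Bollobás–Riordan's proof of Theorem 5.3 for `M_t`

Bollobás–Riordan, *Percolation on self-dual polygon configurations* (2010, arXiv:1001.4674),
§5.1, proof of Theorem 5.3 ("`Pr(J) ≥ Pr(E') ≥ Pr(E)/C`"), transplanted to the corner models
`M_t = cornerPercolation t = (prodBernoulli (cornerParam t)).map cornerConfig`, with the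
constants of line `Sketch`: `n = 32000 k`, `s = k`, `m = 1600 k`, gap bound `360000 k²`.

THE PRODUCT-SPACE BOUND. Let `μ = prodBernoulli (cornerParam t)`, `ρ` the uniform law on the
window `shiftWindow k` (part 3), `P = μ ⊗ μ ⊗ ρ` on the resampling data `q = (S₁, S₂, X)`.

* LAW OF `f_ALG`: `M_t(J(n, s)) = μ(cornerConfig⁻¹ J) = P(brSplice⁻¹ cornerConfig⁻¹ J)`
  (`prodBernoulli_apply_eq_preimage_spliceShift`; the examined coins are a stopping set, part 2).
* RECOLOURING: on `E* = {ω₁ ∈ G_ε, ω₂ ∈ NS(m), X good}` (`goodEvent`) the recoloured, spliced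
  configuration is in `J` (`LinkStatement`, the explorations being unchanged by
  `JunctionStatement`), the site of the recolouring is read off the recoloured datum, and the
  imposed pattern costs `≤ 16` (part 3); so `P(J~) ≥ P(E*)/16` (`mul_prod_le_of_reconstructible`,
  measurability from part 2).
* FUBINI: `P(E*) ≥ μ(G_ε~) μ(NS~) / 6000 ≥ c₃ c₂ / 6000` (good shifts and the uniform window law,
  part 3).

Hence `M_t(J(32000k, k)) ≥ c₂ c₃ / 96000` whenever `M_t(NS(1600k)) ≥ c₂` and
`M_t(G_ε(32000k, k)) ≥ c₃` (`ProductBoundStatement` / `productBound_holds`).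

THE STUB. Given the Non-Slant lemma (`NonSlantStatement`: `c₂`, `n₀`), the exploration API
(`BridgeStatement ∧ ExaminedStatement`), B–R's Lemma 5.6 (`SmallGapStatement`: `c₃`), the
junction invariance and the link: for every `t` and every `k ≥ n₀ + 1`, either
`M_t(J(n, s)) ≥ c₃` outright or `M_t(G_ε) ≥ c₃` and then `M_t(J(n, s)) ≥ c₂ c₃ / 96000`; so
`M_t(J(32000k, k)) ≥ min c₃ (c₂ c₃ / 96000)` uniformly, and part 1 (JOIN ⇒ hard-way crossing,
every width) gives `TBStatement`.
-/

noncomputable section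

namespace Summit.CriticalPhenomena.CardyFormulaZ2.Cruxes.UniformBoxCrossing.NonSlantLine

open MeasureTheory SimpleGraph Finset Literature.Probability.Percolation Literature.Probability.LatticeModels
open scoped ENNReal

/-- **Fubini lower bound on a triple product**: if every section of `E` over `A × B` has
`μ₃`-measure `≥ r`, then `(μ₁ ⊗ μ₂ ⊗ μ₃)(E) ≥ μ₁(A) μ₂(B) r`. [folklore] -/
theorem mul_mul_le_prod_prod {α β γ : Type*} [MeasurableSpace α] [MeasurableSpace β]
    [MeasurableSpace γ] (μ₁ : Measure α) (μ₂ : Measure β) (μ₃ : Measure γ) [SFinite μ₂] [SFinite μ₃]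
    {E : Set (α × (β × γ))} (hE : MeasurableSet E) {A : Set α} (hA : MeasurableSet A)
    {B : Set β} (hB : MeasurableSet B) {r : ℝ≥0∞}
    (hr : ∀ a ∈ A, ∀ b ∈ B, r ≤ μ₃ {c | (a, (b, c)) ∈ E}) :
    μ₁ A * (μ₂ B * r) ≤ (μ₁.prod (μ₂.prod μ₃)) E := by
  rw [Measure.prod_apply hE]
  calc μ₁ A * (μ₂ B * r)
      = ∫⁻ a, A.indicator (fun _ => μ₂ B * r) a ∂μ₁ := by rw [lintegral_indicator_const hA, mul_comm]
    _ ≤ ∫⁻ a, (μ₂.prod μ₃) (Prod.mk a ⁻¹' E) ∂μ₁ := lintegral_mono fun a => ?_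
  by_cases ha : a ∈ A
  · rw [Set.indicator_of_mem ha, Measure.prod_apply (measurable_prodMk_left hE)]
    calc μ₂ B * r = ∫⁻ b, B.indicator (fun _ => r) b ∂μ₂ := by rw [lintegral_indicator_const hB, mul_comm]
      _ ≤ ∫⁻ b, μ₃ (Prod.mk b ⁻¹' (Prod.mk a ⁻¹' E)) ∂μ₂ := lintegral_mono fun b => ?_
    by_cases hb : b ∈ B
    · rw [Set.indicator_of_mem hb]
      exact hr a ha b hb
    · rw [Set.indicator_of_notMem hb]
      exact zero_le
  · rw [Set.indicator_of_notMem ha]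
    exact zero_le

/-- **Bollobás–Riordan's event `E*`** for the corner coins: `ω₁ = cornerConfig S₁` is in the
small-gap event, `ω₂ = cornerConfig S₂` has a non-slant path in `[0, 1600k]²`, and the shift `X`
is good. [cite: BollobasRiordan2010, §5.1 proof of Thm. 5.3] -/
def goodEvent (k : ℕ) : Set (Set (Site 2 × Fin 2) × (Set (Site 2 × Fin 2) × Site 2)) :=
  {q | cornerConfig q.1 ∈ smallGapEvent (32000 * k) k (360000 * k ^ 2) ∧
    cornerConfig q.2.1 ∈ nonSlant (1600 * k) ∧ q ∈ goodSet (32000 * k) k (1600 * k)}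

/-- The event `E*` is measurable. [folklore] -/
theorem measurableSet_goodEvent (k : ℕ) : MeasurableSet (goodEvent k) :=
  (measurable_fst (measurable_cornerConfig (measurableSet_smallGapEvent _ _ _))).inter
    (((measurable_fst.comp measurable_snd) (measurable_cornerConfig (measurableSet_nonSlant _))).inter
      (measurableSet_goodSet _ _ _))

/-- **The recolouring inequality for `f_ALG`** (Bollobás–Riordan 2010, proof of Thm. 5.3 with
§5.2: "`Pr(E') ≥ Pr(E)/C`"): for every probability law `ρ` of the shift,
`(1/16) · P(E*) ≤ P(brSplice⁻¹ cornerConfig⁻¹ J(n, s))`, `P = μ ⊗ μ ⊗ ρ`: on `E*` the recoloured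
datum splices into `J` (`LinkStatement`, explorations unchanged by `JunctionStatement`), the
site is reconstructible (it only depends on the unchanged explorations and on `(S₂, X)`), and the
pattern costs `≤ 16`. [cite: BollobasRiordan2010, §5.2] -/
theorem sixteenth_mul_goodEvent_le (hexplore : BridgeStatement ∧ ExaminedStatement)
    (hjunction : JunctionStatement) (hlink : LinkStatement) (t : unitInterval) (k : ℕ) (hk : 1 ≤ k)
    (ρ : Measure (Site 2)) [IsProbabilityMeasure ρ] :
    ENNReal.ofReal (1 / 16) *
        ((prodBernoulli (cornerParam t)).prod ((prodBernoulli (cornerParam t)).prod ρ)) (goodEvent k) ≤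
      ((prodBernoulli (cornerParam t)).prod ((prodBernoulli (cornerParam t)).prod ρ))
        (brSplice (32000 * k) k ⁻¹' (cornerConfig ⁻¹' joinEvent (32000 * k) k)) := by
  have hkn : k ≤ 32000 * k := by omega
  have h𝒮 : IsStoppingSet (examinedCoins (32000 * k) k) := isStoppingSet_examinedCoins hexplore.2 _ _
  have hη : Measurable fun q : Set (Site 2 × Fin 2) × (Set (Site 2 × Fin 2) × Site 2) => coinShift q.2.2 '' q.2.1 :=
    (measurable_image_equiv_prod coinShift).comp measurable_snd
  have hJm : MeasurableSet (brSplice (32000 * k) k ⁻¹' (cornerConfig ⁻¹' joinEvent (32000 * k) k)) :=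
    (measurable_splice h𝒮 hη) (measurable_cornerConfig (measurableSet_joinEvent _ _))
  refine mul_prod_le_of_reconstructible (cornerParam t) ((prodBernoulli (cornerParam t)).prod ρ)
    (κ := juncSite (32000 * k) k (1600 * k)) (π := juncPattern (32000 * k) k (1600 * k))
    (κ' := juncSite (32000 * k) k (1600 * k))
    (measurableSet_juncSite_juncPattern_eq _ _ _) (measurableSet_juncSite_eq _ _ _) hJm
    (fun q _ => juncPattern_subset_juncSite _ _ _ q) (fun q hq => ?_) (fun q hq => ?_)
    (fun q _ => ENNReal.ofReal_le_of_le_toReal (sixteenth_le_real_juncCylinder t _ _ _ q))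
  · -- the recoloured datum splices into `J`
    obtain ⟨⟨hH1, hH2, hdisj, -⟩, hN, hfst, hsnd, hstrip⟩ := hq
    obtain ⟨hD1, hD2⟩ := hjunction (32000 * k) k (1600 * k) q.1 q.2.1 q.2.2 hk hkn hdisj hfst hsnd
    exact hlink hexplore.1 hexplore.2 (32000 * k) k (1600 * k) q.1 q.2.1 q.2.2 hk hkn hH1 hH2 hdisj
      hN hfst hsnd hstrip hD1 hD2
  · -- the site is reconstructible
    obtain ⟨⟨-, -, hdisj, -⟩, -, hfst, hsnd, -⟩ := hq
    obtain ⟨hD1, hD2⟩ := hjunction (32000 * k) k (1600 * k) q.1 q.2.1 q.2.2 hk hkn hdisj hfst hsnd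
    have hD1' : dualBelow (32000 * k) (cornerConfig (setOn (juncSite (32000 * k) k (1600 * k) q)
        ↑(juncPattern (32000 * k) k (1600 * k) q) q.1)) = dualBelow (32000 * k) (cornerConfig q.1) := hD1
    have hD2' : dualAbove (32000 * k) k (cornerConfig (setOn (juncSite (32000 * k) k (1600 * k) q)
        ↑(juncPattern (32000 * k) k (1600 * k) q) q.1)) = dualAbove (32000 * k) k (cornerConfig q.1) := hD2
    show junctionCorners (lowerRegion (32000 * k) (cornerConfig (setOn (juncSite (32000 * k) k (1600 * k) q)
        ↑(juncPattern (32000 * k) k (1600 * k) q) q.1)))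
        (upperRegion (32000 * k) k (cornerConfig (setOn (juncSite (32000 * k) k (1600 * k) q)
          ↑(juncPattern (32000 * k) k (1600 * k) q) q.1)))
        (linkWalk (1600 * k) q.2.1 q.2.2) ×ˢ Finset.univ =
      junctionCorners (lowerRegion (32000 * k) (cornerConfig q.1))
        (upperRegion (32000 * k) k (cornerConfig q.1)) (linkWalk (1600 * k) q.2.1 q.2.2) ×ˢ Finset.univ
    rw [lowerRegion_congr _ hD1', upperRegion_congr _ _ hD2']

/-- Statement form of `productBound_holds` — "`M_t(NS(1600k)) ≥ c₂` and `M_t(G_ε) ≥ c₃` give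
`M_t(J(32000k, k)) ≥ c₂ c₃ / 96000`": a registered glue step the LINE POSITS and proves right below;
not a literature fact, never to be relocated. -/
def ProductBoundStatement : Prop :=
  BridgeStatement ∧ ExaminedStatement → JunctionStatement → LinkStatement →
    ∀ (t : unitInterval) (k : ℕ), 1 ≤ k → ∀ (c₂ c₃ : ℝ), 0 ≤ c₂ → 0 ≤ c₃ →
      c₂ ≤ (cornerPercolation t).real (nonSlant (1600 * k)) →
      c₃ ≤ (cornerPercolation t).real (smallGapEvent (32000 * k) k (360000 * k ^ 2)) →
      c₂ * c₃ / 96000 ≤ (cornerPercolation t).real (joinEvent (32000 * k) k)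

/-- **The product-space bound** (Bollobás–Riordan 2010, proof of Thm. 5.3 for `M_t`):
`M_t(J(32000k, k)) ≥ c₂ c₃ / 96000` — law of `f_ALG`, recolouring inequality, Fubini with the
good-shift count. [cite: BollobasRiordan2010, §5.1 proof of Thm. 5.3] -/
theorem productBound_holds : ProductBoundStatement := by
  intro hexplore hjunction hlink t k hk c₂ c₃ hc₂ hc₃ h₂ h₃
  set μ : Measure (Set (Site 2 × Fin 2)) := prodBernoulli (cornerParam t) with hμ
  set ρ : Measure (Site 2) := (PMF.uniformOfFinset (shiftWindow k) (shiftWindow_nonempty k)).toMeasure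
    with hρ
  -- measurability
  have hGεm : MeasurableSet (smallGapEvent (32000 * k) k (360000 * k ^ 2)) :=
    measurableSet_smallGapEvent _ _ _
  have hNSm : MeasurableSet (nonSlant (1600 * k)) := measurableSet_nonSlant _
  have hJtm : MeasurableSet (cornerConfig ⁻¹' joinEvent (32000 * k) k) :=
    measurable_cornerConfig (measurableSet_joinEvent _ _)
  -- the hypotheses in `ℝ≥0∞` form
  have hc₂' : ENNReal.ofReal c₂ ≤ μ (cornerConfig ⁻¹' nonSlant (1600 * k)) := by
    refine ENNReal.ofReal_le_of_le_toReal ?_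
    rw [← measureReal_def, hμ, ← cornerPercolation_real_apply t hNSm]
    exact h₂
  have hc₃' : ENNReal.ofReal c₃ ≤ μ (cornerConfig ⁻¹' smallGapEvent (32000 * k) k (360000 * k ^ 2)) := by
    refine ENNReal.ofReal_le_of_le_toReal ?_
    rw [← measureReal_def, hμ, ← cornerPercolation_real_apply t hGεm]
    exact h₃
  -- (ii) the law of `f_ALG`
  have hlaw : μ (cornerConfig ⁻¹' joinEvent (32000 * k) k) =
      (μ.prod (μ.prod ρ)) (brSplice (32000 * k) k ⁻¹' (cornerConfig ⁻¹' joinEvent (32000 * k) k)) :=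
    prodBernoulli_apply_eq_preimage_spliceShift (cornerParam t)
      (isStoppingSet_examinedCoins hexplore.2 _ _) ρ coinShift (cornerParam_coinShift t) hJtm
  -- (iv) the recolouring inequality
  have hrecol := sixteenth_mul_goodEvent_le hexplore hjunction hlink t k hk ρ
  -- (v) Fubini with the good-shift count
  have hPE : ENNReal.ofReal c₃ * (ENNReal.ofReal c₂ * ENNReal.ofReal (1 / 6000)) ≤
      (μ.prod (μ.prod ρ)) (goodEvent k) := by
    refine le_trans (mul_le_mul' hc₃' (mul_le_mul' hc₂' le_rfl)) ?_
    refine mul_mul_le_prod_prod μ μ ρ (measurableSet_goodEvent k) (measurable_cornerConfig hGεm)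
      (measurable_cornerConfig hNSm) fun S₁ hS₁ S₂ hS₂ => ?_
    obtain ⟨Xs, hsub, hcard, hgood⟩ := exists_goodShifts_cornerConfig k hk hS₁ hS₂
    refine (uniform_shiftWindow_ge k hk hsub hcard).trans (measure_mono fun X hX => ?_)
    exact ⟨hS₁, hS₂, hgood X (Finset.mem_coe.1 hX)⟩
  -- assemble
  have hfin : ENNReal.ofReal (c₂ * c₃ / 96000) ≤ μ (cornerConfig ⁻¹' joinEvent (32000 * k) k) := by
    calc ENNReal.ofReal (c₂ * c₃ / 96000)
        = ENNReal.ofReal (1 / 16) *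
            (ENNReal.ofReal c₃ * (ENNReal.ofReal c₂ * ENNReal.ofReal (1 / 6000))) := by
          rw [← ENNReal.ofReal_mul hc₂, ← ENNReal.ofReal_mul hc₃,
            ← ENNReal.ofReal_mul (by norm_num : (0 : ℝ) ≤ 1 / 16)]
          congr 1
          ring
      _ ≤ ENNReal.ofReal (1 / 16) * (μ.prod (μ.prod ρ)) (goodEvent k) := mul_le_mul' le_rfl hPE
      _ ≤ (μ.prod (μ.prod ρ)) (brSplice (32000 * k) k ⁻¹' (cornerConfig ⁻¹' joinEvent (32000 * k) k)) :=
          hrecol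
      _ = μ (cornerConfig ⁻¹' joinEvent (32000 * k) k) := hlaw.symm
  rw [cornerPercolation_real_apply t (measurableSet_joinEvent _ _), measureReal_def]
  exact (ENNReal.ofReal_le_iff_le_toReal (measure_ne_top _ _)).1 hfin

/-! ### The stub -/

/-- **Stub 7 (assembly)** — Bollobás–Riordan 2010, proof of Thm. 5.3, probabilistic wrapping for
`M_t`: the law of `brSplice` (`prodBernoulli_apply_eq_preimage_spliceShift`, stopping set from
`ExaminedStatement`), `goodShifts` integrated over `(ω₁, ω₂)` with `X` uniform on the window, the
recolouring inequality `mul_prod_le_of_reconstructible` (site `juncSite`, pattern `juncPattern`,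
`δ = 1/16`), then JOIN ⇒ hard-way `TB([0,n] × [0,n+k])` at `n = 32000k`, and all `n` by
monotonicity of `tbCrossing` in the width. [cite: BollobasRiordan2010, §5.1 proof of Thm. 5.3] -/
theorem stub_assembly (hNS : NonSlantStatement) (hexplore : BridgeStatement ∧ ExaminedStatement)
    (hgap : SmallGapStatement) (hjunction : JunctionStatement) (hlink : LinkStatement) :
    TBStatement := by
  obtain ⟨c₂, hc₂, n₀, hNS'⟩ := hNS
  obtain ⟨c₃, hc₃, hgap'⟩ := hgap
  refine tbOfJoin_holds (min c₃ (c₂ * c₃ / 96000)) (lt_min hc₃ (by positivity)) (n₀ + 1)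
    fun t k hk hk1 => ?_
  have h₂ : c₂ ≤ (cornerPercolation t).real (nonSlant (1600 * k)) := hNS' t (1600 * k) (by omega)
  rcases hgap' t k hk1 with hJ | hG
  · exact (min_le_left _ _).trans hJ
  · exact (min_le_right _ _).trans
      (productBound_holds hexplore hjunction hlink t k hk1 c₂ c₃ hc₂.le hc₃.le h₂ hG)

end Summit.CriticalPhenomena.CardyFormulaZ2.Cruxes.UniformBoxCrossing.NonSlantLine

end
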